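import Summits.KontsevichZagierPeriods.KontsevichZagierPeriods.Theorems.SoloBlindBeta
import HarnessLib

/-!
# Euler's lemniscate relation inside the three rules, I: the line integrals

The two halves of Euler's 1782 relation `a · b = π/4`,
`a = ∫₀¹ dx/√(1-x⁴)` (half the arc length of Bernoulli's lemniscate) and
`b = ∫₀¹ x² dx/√(1-x⁴)`, as ALGEBRAIC one-dimensional integral representations

* `lemnA1 = [(0,1), 1/√(1-x⁴)]`, `lemnB1 = [(0,1), x²/√(1-x⁴)]`,

and ONE change of variables `t = x⁴` each (`KZ` rule (2), via `lineRep_subst`), landing on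
scaled Beta representations of `SoloBlindBeta`:

* `lemnA1_sub_beta`, `lemnB1_sub_beta`; in `Q = FormalRep ⧸ relations`:
  `mkQ_lemnA1 : [A₁] = ¼ β(¼,½)`, `mkQ_lemnB1 : [B₁] = ¼ β(¾,½)`.

The ℚ-rational subgraph representations and the Newton–Leibniz moves onto `A₁`, `B₁` are in
part II (`SoloBlindLemniscateReps`); the relation is assembled in `SoloBlindLemniscate`.
This is the first ELLIPTIC (genus-one, CM) period treated in this series.

References: L. Euler, *De miris proprietatibus curvae elasticae…*, E605 (1786);
M. Kontsevich, D. Zagier, *Periods* (2001), §1.1–1.2; G. Andrews, R. Askey, R. Roy,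
*Special Functions* (1999), §1.1.
-/

noncomputable section

namespace Summit.KontsevichZagierPeriods.KontsevichZagierPeriods.Theorems

open Set MeasureTheory
open Literature.ModelTheory.ExponentialFields (IsSemialgebraic isSemialgebraic_setOf_eval_pos
  isSemialgebraic_setOf_eval_le isSemialgebraic_setOf_eval_lt isSemialgebraic_setOf_eval_nonneg)
open MvPolynomial (aeval X)
open Literature.NumberTheory.Transcendental
open Literature.NumberTheory.Transcendental.KZ
open Literature.Analysis.SpecialFunctions.Selberg
  (integrableOn_Ioo_rpow_mul_one_sub_rpow_and_integral_eq)

namespace SoloBlind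

/-! ## Elementary estimates on `(0,1)` -/

section estimates

variable {x : ℝ}

/-- `x⁴ < 1` on `(0,1)`. -/
theorem pow_four_lt_one (hx : x ∈ Ioo (0:ℝ) 1) : x ^ 4 < 1 :=
  pow_lt_one₀ hx.1.le hx.2 (by norm_num)

/-- `0 < 1 - x⁴` on `(0,1)`. -/
theorem one_sub_pow_four_pos (hx : x ∈ Ioo (0:ℝ) 1) : 0 < 1 - x ^ 4 :=
  sub_pos.mpr (pow_four_lt_one hx)

/-- `0 < √(1 - x⁴)` on `(0,1)`. -/
theorem sqrt_one_sub_pow_four_pos (hx : x ∈ Ioo (0:ℝ) 1) : 0 < Real.sqrt (1 - x ^ 4) :=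
  Real.sqrt_pos.mpr (one_sub_pow_four_pos hx)

/-- `x⁴ ≤ x` on `(0,1)`. -/
theorem pow_four_le_self (hx : x ∈ Ioo (0:ℝ) 1) : x ^ 4 ≤ x := by
  have h3 : x ^ 3 ≤ 1 := pow_le_one₀ hx.1.le hx.2.le
  nlinarith [hx.1]

/-- Domination: `1/√(1-x⁴) ≤ 1/√(1-x)` on `(0,1)`. -/
theorem one_div_sqrt_one_sub_pow_four_le (hx : x ∈ Ioo (0:ℝ) 1) :
    1 / Real.sqrt (1 - x ^ 4) ≤ 1 / Real.sqrt (1 - x) := by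
  have h1 : 0 < 1 - x := sub_pos.mpr hx.2
  exact one_div_le_one_div_of_le (Real.sqrt_pos.mpr h1)
    (Real.sqrt_le_sqrt (by linarith [pow_four_le_self hx]))

/-- `y ≤ c/√w ↔ y²w ≤ c²` for `w > 0`, `y, c ≥ 0` (the subgraph of `c/√w` polynomially). -/
theorem le_div_sqrt_iff {y w c : ℝ} (hw : 0 < w) (hy : 0 ≤ y) (hc : 0 ≤ c) :
    y ≤ c / Real.sqrt w ↔ y ^ 2 * w ≤ c ^ 2 := by
  have hs := Real.sqrt_pos.mpr hw
  rw [le_div_iff₀ hs, ← pow_le_pow_iff_left₀ (mul_nonneg hy hs.le) hc two_ne_zero, mul_pow,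
    Real.sq_sqrt hw.le]

/-- `1/√(1-x) = x^{1-1}(1-x)^{1/2-1}` on `(0,1)` (the dominating Beta integrand). -/
theorem one_div_sqrt_eq_betaIntegrand (hx : x ∈ Ioo (0:ℝ) 1) :
    1 / Real.sqrt (1 - x) = x ^ ((1:ℝ) - 1) * (1 - x) ^ ((1:ℝ) / 2 - 1) := by
  have h1 : 0 < 1 - x := sub_pos.mpr hx.2
  rw [sub_self, Real.rpow_zero, one_mul, show (1:ℝ) / 2 - 1 = -((1:ℝ) / 2) by norm_num,
    Real.rpow_neg h1.le, ← Real.sqrt_eq_rpow, inv_eq_one_div]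

end estimates

/-! ## The two algebraic one-dimensional representations -/

/-- `1/√(1-x⁴)` is integrable on `(0,1)` (dominated by the Beta integrand `(1-x)^{-1/2}`). -/
theorem integrableOn_lemnA : IntegrableOn (fun x : ℝ => 1 / Real.sqrt (1 - x ^ 4)) (Ioo 0 1) := by
  have hg := (integrableOn_Ioo_rpow_mul_one_sub_rpow_and_integral_eq (a := 1) (b := 1 / 2)
    one_pos (by norm_num)).1
  refine Integrable.mono' hg ?_ ?_
  · refine ContinuousOn.aestronglyMeasurable (continuousOn_const.div ?_ fun x hx =>
      (sqrt_one_sub_pow_four_pos hx).ne') measurableSet_Ioo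
    exact (by fun_prop : Continuous fun x : ℝ => Real.sqrt (1 - x ^ 4)).continuousOn
  · refine (ae_restrict_iff' measurableSet_Ioo).mpr (Filter.Eventually.of_forall fun x hx => ?_)
    rw [Real.norm_eq_abs, abs_of_pos (one_div_pos.mpr (sqrt_one_sub_pow_four_pos hx)),
      ← one_div_sqrt_eq_betaIntegrand hx]
    exact one_div_sqrt_one_sub_pow_four_le hx

/-- `x²/√(1-x⁴)` is integrable on `(0,1)`. -/
theorem integrableOn_lemnB :
    IntegrableOn (fun x : ℝ => x ^ 2 / Real.sqrt (1 - x ^ 4)) (Ioo 0 1) := by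
  have hg := (integrableOn_Ioo_rpow_mul_one_sub_rpow_and_integral_eq (a := 1) (b := 1 / 2)
    one_pos (by norm_num)).1
  refine Integrable.mono' hg ?_ ?_
  · refine ContinuousOn.aestronglyMeasurable (ContinuousOn.div (by fun_prop) ?_ fun x hx =>
      (sqrt_one_sub_pow_four_pos hx).ne') measurableSet_Ioo
    exact (by fun_prop : Continuous fun x : ℝ => Real.sqrt (1 - x ^ 4)).continuousOn
  · refine (ae_restrict_iff' measurableSet_Ioo).mpr (Filter.Eventually.of_forall fun x hx => ?_)
    have hs := sqrt_one_sub_pow_four_pos hx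
    have hx2 : x ^ 2 ≤ 1 := pow_le_one₀ hx.1.le hx.2.le
    rw [Real.norm_eq_abs, abs_of_pos (div_pos (pow_pos hx.1 2) hs),
      ← one_div_sqrt_eq_betaIntegrand hx]
    exact (div_le_div_of_nonneg_right hx2 hs.le).trans (one_div_sqrt_one_sub_pow_four_le hx)

/-- `1/√(1-x⁴)` is `ℚ`-semialgebraic on `(0,1)` (it is `(1-x⁴)^{-1/2}`). -/
theorem isSemialgebraicFunOn_lemnA :
    IsSemialgebraicFunOn ℚ (line (Ioo 0 1)) (fun x : Fin 1 → ℝ => 1 / Real.sqrt (1 - x 0 ^ 4)) := by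
  have h := isSemialgebraicFunOn_mellinIntegrand
    (isSemialgebraic_line_Ioo isAlgebraic_zero isAlgebraic_one)
    ![(1 - X 0 ^ 4 : MvPolynomial (Fin 1) ℚ)] ![(-1 / 2 : ℚ)] 1 (fun x hx k => by
      have hx : x 0 ∈ Ioo (0:ℝ) 1 := hx
      simpa using one_sub_pow_four_pos hx)
  refine h.congr fun x hx => ?_
  have hx : x 0 ∈ Ioo (0:ℝ) 1 := hx
  have hw := one_sub_pow_four_pos hx
  simp only [mellinIntegrand_apply, Fin.prod_univ_one, Matrix.cons_val_fin_one, map_sub, map_one,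
    map_pow, MvPolynomial.aeval_X]
  push_cast
  rw [show (-1 / 2 : ℝ) = -((1:ℝ) / 2) by norm_num, Real.rpow_neg hw.le, ← Real.sqrt_eq_rpow,
    one_mul, inv_eq_one_div]

/-- `x²/√(1-x⁴)` is `ℚ`-semialgebraic on `(0,1)`. -/
theorem isSemialgebraicFunOn_lemnB :
    IsSemialgebraicFunOn ℚ (line (Ioo 0 1))
      (fun x : Fin 1 → ℝ => x 0 ^ 2 / Real.sqrt (1 - x 0 ^ 4)) := by
  refine (IsSemialgebraicFunOn.mul_holds
    (isSemialgebraicFunOn_aeval (isSemialgebraic_line_Ioo isAlgebraic_zero isAlgebraic_one)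
      (X 0 ^ 2 : MvPolynomial (Fin 1) ℚ)) isSemialgebraicFunOn_lemnA).congr fun x _ => ?_
  simp only [Pi.mul_apply, map_pow, MvPolynomial.aeval_X, mul_one_div]

/-- **`A₁ = [(0,1), 1/√(1-x⁴)]`** (value `a = ϖ/2`, half the lemniscate constant). -/
def lemnA1 : IntegralRep 1 :=
  lineRep (Ioo 0 1) (fun x => 1 / Real.sqrt (1 - x ^ 4))
    (isSemialgebraic_line_Ioo isAlgebraic_zero isAlgebraic_one) isSemialgebraicFunOn_lemnA
    integrableOn_lemnA

/-- **`B₁ = [(0,1), x²/√(1-x⁴)]`** (value `b`). -/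
def lemnB1 : IntegralRep 1 :=
  lineRep (Ioo 0 1) (fun x => x ^ 2 / Real.sqrt (1 - x ^ 4))
    (isSemialgebraic_line_Ioo isAlgebraic_zero isAlgebraic_one) isSemialgebraicFunOn_lemnB
    integrableOn_lemnB

/-! ## The change of variables `t = x⁴` -/

/-- `x ↦ x⁴` is `ℚ`-semialgebraic on `(0,1)`. -/
theorem isSemialgebraicFunOn_pow_four :
    IsSemialgebraicFunOn ℚ (line (Ioo 0 1)) (fun x : Fin 1 → ℝ => x 0 ^ 4) :=
  (isSemialgebraicFunOn_aeval (isSemialgebraic_line_Ioo isAlgebraic_zero isAlgebraic_one)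
    (X 0 ^ 4 : MvPolynomial (Fin 1) ℚ)).congr fun x _ => by simp

/-- `d(x⁴)/dx = 4x³` within any set. -/
theorem hasDerivWithinAt_pow_four (S : Set ℝ) (t : ℝ) :
    HasDerivWithinAt (fun x : ℝ => x ^ 4) (4 * t ^ 3) S t := by
  simpa using (hasDerivAt_pow 4 t).hasDerivWithinAt

/-- `x ↦ x⁴` is injective on `(0,1)`. -/
theorem injOn_pow_four : InjOn (fun x : ℝ => x ^ 4) (Ioo 0 1) := fun x hx y hy h =>
  (pow_left_inj₀ hx.1.le hy.1.le (by norm_num : (4:ℕ) ≠ 0)).mp h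

/-- `x ↦ x⁴` maps `(0,1)` onto `(0,1)`. -/
theorem image_pow_four : Ioo (0:ℝ) 1 = (fun x : ℝ => x ^ 4) '' Ioo 0 1 := by
  ext t
  constructor
  · rintro ⟨h0, h1⟩
    refine ⟨t ^ ((1:ℝ) / 4), ⟨Real.rpow_pos_of_pos h0 _, Real.rpow_lt_one h0.le h1 (by norm_num)⟩,
      ?_⟩
    show (t ^ ((1:ℝ) / 4)) ^ 4 = t
    rw [← Real.rpow_natCast, ← Real.rpow_mul h0.le]
    norm_num
  · rintro ⟨x, hx, rfl⟩
    exact ⟨pow_pos hx.1 4, pow_four_lt_one hx⟩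

section pullback

variable {x : ℝ}

/-- `(x⁴)^{1/4 - 1} = x⁻³` for `x > 0`. -/
theorem pow_four_rpow_quarter_sub_one (hx : 0 < x) :
    (x ^ 4) ^ ((((1:ℚ) / 4 : ℚ) : ℝ) - 1) = (x ^ 3)⁻¹ := by
  rw [← Real.rpow_natCast x 4, ← Real.rpow_mul hx.le, ← Real.rpow_natCast x 3,
    ← Real.rpow_neg hx.le]
  norm_num

/-- `(x⁴)^{3/4 - 1} = x⁻¹` for `x > 0`. -/
theorem pow_four_rpow_three_quarters_sub_one (hx : 0 < x) :
    (x ^ 4) ^ ((((3:ℚ) / 4 : ℚ) : ℝ) - 1) = x⁻¹ := by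
  rw [← Real.rpow_natCast x 4, ← Real.rpow_mul hx.le, ← Real.rpow_neg_one]
  norm_num

/-- `(1-x⁴)^{1/2 - 1} = 1/√(1-x⁴)` on `(0,1)`. -/
theorem one_sub_pow_four_rpow_half_sub_one (hx : x ∈ Ioo (0:ℝ) 1) :
    (1 - x ^ 4) ^ ((((1:ℚ) / 2 : ℚ) : ℝ) - 1) = (Real.sqrt (1 - x ^ 4))⁻¹ := by
  rw [Real.sqrt_eq_rpow, ← Real.rpow_neg (one_sub_pow_four_pos hx).le]
  norm_num

/-- The pull-back identity for `A`: `1/√(1-x⁴) = ¼ (x⁴)^{-3/4}(1-x⁴)^{-1/2} · |4x³|`. -/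
theorem lemnA_pullback (hx : x ∈ Ioo (0:ℝ) 1) :
    1 / Real.sqrt (1 - x ^ 4) =
      (((1:ℚ) / 4 : ℚ) : ℝ) * ((x ^ 4) ^ ((((1:ℚ) / 4 : ℚ) : ℝ) - 1) *
        (1 - x ^ 4) ^ ((((1:ℚ) / 2 : ℚ) : ℝ) - 1)) * |4 * x ^ 3| := by
  have h0 := hx.1
  have hs := sqrt_one_sub_pow_four_pos hx
  rw [pow_four_rpow_quarter_sub_one h0, one_sub_pow_four_rpow_half_sub_one hx,
    abs_of_pos (by positivity)]
  push_cast
  field_simp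

/-- The pull-back identity for `B`: `x²/√(1-x⁴) = ¼ (x⁴)^{-1/4}(1-x⁴)^{-1/2} · |4x³|`. -/
theorem lemnB_pullback (hx : x ∈ Ioo (0:ℝ) 1) :
    x ^ 2 / Real.sqrt (1 - x ^ 4) =
      (((1:ℚ) / 4 : ℚ) : ℝ) * ((x ^ 4) ^ ((((3:ℚ) / 4 : ℚ) : ℝ) - 1) *
        (1 - x ^ 4) ^ ((((1:ℚ) / 2 : ℚ) : ℝ) - 1)) * |4 * x ^ 3| := by
  have h0 := hx.1
  have hs := sqrt_one_sub_pow_four_pos hx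
  rw [pow_four_rpow_three_quarters_sub_one h0, one_sub_pow_four_rpow_half_sub_one hx,
    abs_of_pos (by positivity)]
  push_cast
  field_simp

end pullback

/-- A scaled Beta representation, spelled out as a representation on the line. -/
theorem betaRep_constMul_eq_lineRep {a b : ℚ} (ha : 0 < a) (hb : 0 < b) (q : ℚ) :
    (betaRep a b ha hb).constMul (q : ℝ) (isAlgebraic_rat ℚ q) =
      lineRep (Ioo 0 1) (fun t => (q : ℝ) * (t ^ ((a : ℝ) - 1) * (1 - t) ^ ((b : ℝ) - 1)))
        (isSemialgebraic_line_Ioo isAlgebraic_zero isAlgebraic_one)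
        ((isSemialgebraicFunOn_const_mul_rpow_mul_rpow q (a - 1) (b - 1)).congr fun x _ => by
          push_cast
          ring)
        ((integrableOn_Ioo_rpow_mul_one_sub_rpow_and_integral_eq (Rat.cast_pos.mpr ha)
          (Rat.cast_pos.mpr hb)).1.const_mul _) :=
  IntegralRep.ext' rfl rfl

/-- **Move (change of variables `t = x⁴`): `A₁ ≡ ¼ · β(¼,½)`.** -/
theorem lemnA1_sub_beta :
    of lemnA1 - of ((betaRep (1 / 4) (1 / 2) (by norm_num) (by norm_num)).constMul
      (((1:ℚ) / 4 : ℚ) : ℝ) (isAlgebraic_rat ℚ _)) ∈ relations := by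
  rw [betaRep_constMul_eq_lineRep]
  unfold lemnA1
  exact lineRep_subst (fun x => x ^ 4) (fun x => 4 * x ^ 3) isSemialgebraicFunOn_pow_four
    (fun t _ => hasDerivWithinAt_pow_four _ t) injOn_pow_four image_pow_four
    (fun x hx => lemnA_pullback hx)

/-- **Move (change of variables `t = x⁴`): `B₁ ≡ ¼ · β(¾,½)`.** -/
theorem lemnB1_sub_beta :
    of lemnB1 - of ((betaRep (3 / 4) (1 / 2) (by norm_num) (by norm_num)).constMul
      (((1:ℚ) / 4 : ℚ) : ℝ) (isAlgebraic_rat ℚ _)) ∈ relations := by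
  rw [betaRep_constMul_eq_lineRep]
  unfold lemnB1
  exact lineRep_subst (fun x => x ^ 4) (fun x => 4 * x ^ 3) isSemialgebraicFunOn_pow_four
    (fun t _ => hasDerivWithinAt_pow_four _ t) injOn_pow_four image_pow_four
    (fun x hx => lemnB_pullback hx)

/-- `[A₁] = ¼ β(¼,½)` in `Q`. -/
theorem mkQ_lemnA1 : mkQ (of lemnA1) = (((1:ℚ) / 4 : ℚ) : K₀) • betaQ (1 / 4) (1 / 2) := by
  rw [betaQ_eq (by norm_num) (by norm_num), ← mkQ_constMul_ratCast, mkQ_eq_mkQ_iff]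
  exact lemnA1_sub_beta

/-- `[B₁] = ¼ β(¾,½)` in `Q`. -/
theorem mkQ_lemnB1 : mkQ (of lemnB1) = (((1:ℚ) / 4 : ℚ) : K₀) • betaQ (3 / 4) (1 / 2) := by
  rw [betaQ_eq (by norm_num) (by norm_num), ← mkQ_constMul_ratCast, mkQ_eq_mkQ_iff]
  exact lemnB1_sub_beta

end SoloBlind

end Summit.KontsevichZagierPeriods.KontsevichZagierPeriods.Theorems
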